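import Literature.NumberTheory.LFunctions.SuzukiScrewLineRepairedThm14
import HarnessLib

/-!
# CJM (4.8) over the repaired screw line: under RH, `‖P̂ᴿ_φ‖² = π Σ_γ m_γ |(φ̂(γ) − φ̂(0))/γ|²`

LINE 1 — LABEL: RH-CONSEQUENCE identity (explicit binder `RiemannHypothesis →`, never dropped) — the
first display (4.8) of the printed proof of CJM Thm 4.4, read over the repaired `P̂ᴿ` (erratum E21) —
plus its RH-free ingredients ((3.7)ᴿ against the family `F_ρ`, ℓ²/pointwise summability). Theorems only;
no definition, no named fact. bears_on: B-C/B-P (LADDER-RH COLUMN 6 DBR). WHAT THIS IS NOT: the second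
half of the printed sentence ("the right-hand side of (4.8) equals `π⟨φ,φ⟩_{G_g}`", via (4.9) and (2.2))
is NOT proved here, so clause 2 of `Suzuki2025_thm44R` (RH ⟹ (4.7)ᴿ for all `φ`) stays open; nothing
here bears on the truth of RH.

Source: M. Suzuki, Canad. J. Math. 2025 = arXiv:2301.00421v3, proof of Thm 4.4, (4.8) (TeX l.1288–1296:
"`‖P̂_φ‖²_{L²(ℝ)} = π Σ_γ m_γ |(φ̂(γ) − φ̂(0))/γ|²` by (3.7) and Proposition 4.1").

## What is proved
* `screwPhatR_eq_tsum_screwBasis` (RH-free): at every good real `x`,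
  `P̂ᴿ_φ(x) = Σ_ρ c_ρ F_ρ(x)`, `c_ρ = −√(πm_ρ)(φ̂(γ_ρ) − φ̂(0))/γ_ρ`, `F_ρ = screwBasis ρ`; with
  `exists_norm_hatDiff_le` (`|φ̂(γ_ρ) − φ̂(0)| ≤ M` uniformly: `|Im γ_ρ| < ½`),
  `summable_zeroOrder_div_norm_zeroParam_sq` (`Σ m_ρ/|γ_ρ|² < ∞`), `summable_coeff_mul_screwBasis'`.
* `Suzuki2025_eq48R` — **under RH**, `Σ_ρ m_ρ‖φ̂(γ_ρ) − φ̂(0)‖²/‖γ_ρ‖²` converges and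
  `∫_ℝ ‖P̂ᴿ_φ(x)‖² dx = π Σ_ρ m_ρ ‖φ̂(γ_ρ) − φ̂(0)‖²/‖γ_ρ‖²` (Prop 4.1 orthonormality + Parseval for an
  orthonormal family + the identification of the `L²` sum with the pointwise series).

## References
* [Suzuki2025WeilHilbertSpace] CJM 2025 = arXiv:2301.00421v3, (4.8) (TeX l.1288–1296), (3.7)
  (l.1040–1049), Prop 4.1 (l.1120–1142).
-/

noncomputable section

open MeasureTheory Complex Filter Set Real
open scoped ComplexConjugate Topology ENNReal InnerProductSpace

namespace Literature.NumberTheory.LFunctions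

open ScrewLineRepairedExpansion ZetaZeros

namespace ScrewLineRepairedEq48

/-! ## A. Generic lemmas (private copies of those in `SuzukiScrewLineRepairedThm14`) -/

/-- Parseval for an orthonormal family with ℓ² coefficients. [folklore] -/
private theorem summable_and_norm_sq_tsum {ι E : Type*} [NormedAddCommGroup E]
    [InnerProductSpace ℂ E] [CompleteSpace E] {v : ι → E} (hv : Orthonormal ℂ v) {c : ι → ℂ}
    (hc : Summable fun i ↦ ‖c i‖ ^ 2) :
    Summable (fun i ↦ c i • v i) ∧ ‖∑' i, c i • v i‖ ^ 2 = ∑' i, ‖c i‖ ^ 2 := by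
  classical
  have hV := hv.orthogonalFamily
  have hs : Summable fun i ↦ c i • v i := by
    have h := (hV.summable_iff_norm_sq_summable c).2 hc
    simpa [LinearIsometry.toSpanSingleton_apply] using h
  refine ⟨hs, ?_⟩
  have h1 : Tendsto (fun s : Finset ι ↦ ‖∑ i ∈ s, c i • v i‖ ^ 2) atTop
      (𝓝 (‖∑' i, c i • v i‖ ^ 2)) :=
    ((continuous_norm.pow 2).tendsto _).comp hs.hasSum
  have h2 : Tendsto (fun s : Finset ι ↦ ∑ i ∈ s, ‖c i‖ ^ 2) atTop (𝓝 (∑' i, ‖c i‖ ^ 2)) :=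
    hc.hasSum
  have heq : (fun s : Finset ι ↦ ‖∑ i ∈ s, c i • v i‖ ^ 2) = fun s ↦ ∑ i ∈ s, ‖c i‖ ^ 2 := by
    funext s
    have h := hV.norm_sum c s
    simpa [LinearIsometry.toSpanSingleton_apply] using h
  rw [heq] at h1
  exact tendsto_nhds_unique h1 h2

/-- Representatives of finite sums of `L²` classes. [folklore] -/
private theorem coeFn_finset_sum_toLp {ι : Type*} (s : Finset ι) {f : ι → ℝ → ℂ}
    (hf : ∀ i, MemLp (f i) 2 (volume : Measure ℝ)) (c : ι → ℂ) :
    ((∑ i ∈ s, c i • ((hf i).toLp (f i) : Lp ℂ 2 (volume : Measure ℝ)) : Lp ℂ 2 volume) : ℝ → ℂ)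
      =ᵐ[volume] fun x ↦ ∑ i ∈ s, c i * f i x := by
  classical
  induction s using Finset.induction_on with
  | empty =>
    filter_upwards [Lp.coeFn_zero ℂ 2 (volume : Measure ℝ)] with x hx
    simp only [Finset.sum_empty] at hx ⊢
    exact hx
  | @insert a s ha ih =>
    rw [Finset.sum_insert ha]
    filter_upwards [ih, Lp.coeFn_add (c a • ((hf a).toLp (f a) : Lp ℂ 2 volume))
      (∑ i ∈ s, c i • ((hf i).toLp (f i) : Lp ℂ 2 volume)),
      Lp.coeFn_smul (c a) ((hf a).toLp (f a) : Lp ℂ 2 volume), (hf a).coeFn_toLp] with x hx hadd hsm hfa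
    rw [hadd, Pi.add_apply, hsm, Pi.smul_apply, hfa, hx, Finset.sum_insert ha, smul_eq_mul]

/-- An `L²`-sum of `L²` functions that converges pointwise a.e. is the pointwise sum a.e. [folklore] -/
private theorem coeFn_tsum_ae_eq_tsum {ι : Type*} [Countable ι] {f : ι → ℝ → ℂ}
    (hf : ∀ i, MemLp (f i) 2 (volume : Measure ℝ)) {c : ι → ℂ}
    (hs : Summable fun i ↦ c i • ((hf i).toLp (f i) : Lp ℂ 2 (volume : Measure ℝ)))
    (hpt : ∀ᵐ x : ℝ, Summable fun i ↦ c i * f i x) :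
    ((∑' i, c i • ((hf i).toLp (f i) : Lp ℂ 2 (volume : Measure ℝ)) : Lp ℂ 2 volume) : ℝ → ℂ)
      =ᵐ[volume] fun x ↦ ∑' i, c i * f i x := by
  classical
  set G : Lp ℂ 2 (volume : Measure ℝ) := ∑' i, c i • ((hf i).toLp (f i) : Lp ℂ 2 volume) with hG
  have hT : Tendsto (fun s : Finset ι ↦ ∑ i ∈ s, c i • ((hf i).toLp (f i) : Lp ℂ 2 volume))
      atTop (𝓝 G) := hs.hasSum
  have hM := tendstoInMeasure_of_tendsto_Lp hT
  haveI : (atTop : Filter (Finset ι)).NeBot := atTop_neBot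
  obtain ⟨ns, hns, hae⟩ := hM.exists_seq_tendsto_ae'
  have hrep : ∀ᵐ x : ℝ, ∀ n : ℕ,
      ((∑ i ∈ ns n, c i • ((hf i).toLp (f i) : Lp ℂ 2 volume) : Lp ℂ 2 volume) : ℝ → ℂ) x =
        ∑ i ∈ ns n, c i * f i x := by
    rw [ae_all_iff]
    intro n
    exact coeFn_finset_sum_toLp (ns n) hf c
  filter_upwards [hae, hrep, hpt] with x hx hxrep hxpt
  have h1 : Tendsto (fun n : ℕ ↦ ∑ i ∈ ns n, c i * f i x) atTop (𝓝 (∑' i, c i * f i x)) :=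
    hxpt.hasSum.comp hns
  have h2 : Tendsto (fun n : ℕ ↦ ∑ i ∈ ns n, c i * f i x) atTop (𝓝 ((G : ℝ → ℂ) x)) := by
    refine hx.congr fun n ↦ ?_
    exact hxrep n
  exact tendsto_nhds_unique h2 h1

/-- `‖F‖² = ∫ ‖F(ξ)‖² dξ` for a class `F ∈ L²(ℝ)`. [folklore] -/
private theorem norm_sq_eq_integral_norm_sq (F : Lp ℂ 2 (volume : Measure ℝ)) :
    ‖F‖ ^ 2 = ∫ ξ : ℝ, ‖(F : ℝ → ℂ) ξ‖ ^ 2 := by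
  have h1 : inner ℂ F F = ((‖F‖ ^ 2 : ℝ) : ℂ) := by
    rw [inner_self_eq_norm_sq_to_K]; norm_cast
  have h2 : inner ℂ F F = ((∫ ξ : ℝ, ‖(F : ℝ → ℂ) ξ‖ ^ 2 : ℝ) : ℂ) := by
    rw [L2.inner_def, ← integral_complex_ofReal]
    refine integral_congr_ae (ae_of_all _ fun ξ ↦ ?_)
    beta_reduce
    rw [inner_self_eq_norm_sq_to_K]
    norm_cast
  exact_mod_cast Complex.ofReal_injective (h1.symm.trans h2)

/-! ## B. RH-free ingredients -/

/-- `|φ̂(γ_ρ) − φ̂(0)| ≤ M` uniformly over the zeros (`|Im γ_ρ| < ½`, compact support of `φ`).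
[cite: Suzuki2025WeilHilbertSpace, §3.1 (TeX l.776–781)] -/
theorem exists_norm_hatDiff_le {φ : ℝ → ℂ} (hφ : IsWeilTest φ) :
    ∃ M : ℝ, 0 ≤ M ∧ ∀ ρ : ZetaZeros.riemannZetaNontrivialZeros,
      ‖suzukiHat φ (suzukiZeroParam (ρ : ℂ)) - suzukiHat φ 0‖ ≤ M := by
  obtain ⟨M, hM0, hM⟩ := exists_setIntegral_norm_expCoeffIntegrand_le hφ
  refine ⟨M, hM0, fun ρ ↦ ?_⟩
  have hb : |(I * suzukiZeroParam (ρ : ℂ)).re| ≤ 1 / 2 := by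
    obtain ⟨-, h0, h1⟩ := mem_riemannZetaNontrivialZeros_iff_holds.1 ρ.2
    have : (I * suzukiZeroParam (ρ : ℂ)).re = 1 / 2 - (ρ : ℂ).re := by
      simp [suzukiZeroParam]
    rw [this]; exact abs_le.2 ⟨by linarith, by linarith⟩
  have hφi : Integrable φ := hφ.1.continuous.integrable_of_hasCompactSupport hφ.2
  have h1 : Integrable fun t : ℝ ↦ (cexp (I * suzukiZeroParam (ρ : ℂ) * t) - 1) * φ t :=
    integrableOn_univ.1 (integrableOn_expCoeffIntegrand hφ hb univ)
  have h2 : Integrable fun t : ℝ ↦ φ t * cexp (I * suzukiZeroParam (ρ : ℂ) * t) :=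
    (h1.add hφi).congr (ae_of_all _ fun t ↦ by simp only [Pi.add_apply]; ring)
  have heq : suzukiHat φ (suzukiZeroParam (ρ : ℂ)) - suzukiHat φ 0 =
      ∫ t : ℝ, (cexp (I * suzukiZeroParam (ρ : ℂ) * t) - 1) * φ t := by
    rw [suzukiHat, suzukiHat, ← integral_sub h2 (hφi.congr (ae_of_all _ fun t ↦ by simp))]
    refine integral_congr_ae (ae_of_all _ fun t ↦ ?_)
    simp only [mul_zero, zero_mul, Complex.exp_zero, mul_one]
    ring
  rw [heq]
  refine (norm_integral_le_integral_norm _).trans ?_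
  have h := hM _ hb univ MeasurableSet.univ
  rwa [Measure.restrict_univ] at h

/-- `Σ_ρ m_ρ/|γ_ρ|² < ∞` (`|γ_ρ| = |ρ − ½|`; the tree's `summable_zeroOrder_div_norm_sub_half_sq`).
[cite: Suzuki2025WeilHilbertSpace, §3.1 (TeX l.776–781: "Σ m_γ|γ|^{−1−δ} < ∞")] -/
theorem summable_zeroOrder_div_norm_zeroParam_sq :
    Summable fun ρ : ZetaZeros.riemannZetaNontrivialZeros ↦
      (riemannZetaZeroOrder (ρ : ℂ) : ℝ) / ‖suzukiZeroParam (ρ : ℂ)‖ ^ 2 := by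
  refine ZetaScrewProp31.summable_zeroOrder_div_norm_sub_half_sq.congr fun ρ ↦ ?_
  rw [suzukiZeroParam, norm_mul, Complex.norm_I, one_mul]

/-- **(3.7)ᴿ against the family `F_ρ` of (3.5)**: at every good real `x`,
`P̂ᴿ_φ(x) = Σ_ρ (−√(πm_ρ)(φ̂(γ_ρ) − φ̂(0))/γ_ρ) · F_ρ(x)`. RH-FREE.
[cite: Suzuki2025WeilHilbertSpace, (3.7) (TeX l.1040–1049) with (3.5); erratum E21] -/
theorem screwPhatR_eq_tsum_screwBasis {φ : ℝ → ℂ} (hφ : IsWeilTest φ) {x : ℝ} (hx0 : x ≠ 0)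
    (hE : lagariasE x ≠ 0)
    (hxΓ : ∀ ρ ∈ ZetaZeros.riemannZetaNontrivialZeros, (x : ℂ) ≠ suzukiZeroParam ρ)
    (hxΓ' : ∀ ρ ∈ ZetaZeros.riemannZetaNontrivialZeros, -(x : ℂ) ≠ suzukiZeroParam ρ) :
    screwPhatR φ x = ∑' ρ : ZetaZeros.riemannZetaNontrivialZeros,
      (-((Real.sqrt (Real.pi * riemannZetaZeroOrder (ρ : ℂ)) : ℝ) : ℂ) *
        (suzukiHat φ (suzukiZeroParam (ρ : ℂ)) - suzukiHat φ 0) / suzukiZeroParam (ρ : ℂ)) *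
        screwBasis (ρ : ℂ) x := by
  rw [screwPhatR_eq_tsum_suzukiHat hφ hx0 hE hxΓ hxΓ', ← tsum_mul_left]
  refine tsum_congr fun ρ ↦ ?_
  have hm0 : (0 : ℝ) ≤ riemannZetaZeroOrder (ρ : ℂ) := ZetaZeroSum.zeroOrder_nonneg ρ
  have hmm : ((Real.sqrt (Real.pi * riemannZetaZeroOrder (ρ : ℂ)) : ℝ) : ℂ) *
      ((Real.sqrt ((riemannZetaZeroOrder (ρ : ℂ) : ℝ) / Real.pi) : ℝ) : ℂ) =
      ((riemannZetaZeroOrder (ρ : ℂ) : ℝ) : ℂ) := by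
    rw [← Complex.ofReal_mul, ← Real.sqrt_mul (by positivity), show Real.pi *
      (riemannZetaZeroOrder (ρ : ℂ) : ℝ) * ((riemannZetaZeroOrder (ρ : ℂ) : ℝ) / Real.pi) =
      (riemannZetaZeroOrder (ρ : ℂ) : ℝ) * riemannZetaZeroOrder (ρ : ℂ) by field_simp,
      Real.sqrt_mul_self hm0]
  have hγ : suzukiZeroParam (ρ : ℂ) ≠ 0 := norm_pos_iff.1 (norm_zeroParam_pos ρ)
  have hx : (x : ℂ) - suzukiZeroParam (ρ : ℂ) ≠ 0 := sub_ne_zero.2 (hxΓ ρ ρ.2)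
  rw [screwBasis, show ((riemannZetaZeroOrder (ρ : ℂ) : ℤ) : ℂ) =
    ((riemannZetaZeroOrder (ρ : ℂ) : ℝ) : ℂ) by norm_cast, ← hmm]
  field_simp

/-- The series `Σ_ρ c_ρ F_ρ(x)` of (3.7)ᴿ/(3.5) converges absolutely at every real `x`
(`|c_ρ F_ρ(x)| ≤ (M|1+Θ(x)|/2)·m_ρ/(|γ_ρ||x − γ_ρ|)`). RH-FREE. [cite: Suzuki2025WeilHilbertSpace, §3.1 (TeX l.776–781)] -/
theorem summable_coeff_mul_screwBasis' {φ : ℝ → ℂ} (hφ : IsWeilTest φ) (x : ℝ) :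
    Summable fun ρ : ZetaZeros.riemannZetaNontrivialZeros ↦
      (-((Real.sqrt (Real.pi * riemannZetaZeroOrder (ρ : ℂ)) : ℝ) : ℂ) *
        (suzukiHat φ (suzukiZeroParam (ρ : ℂ)) - suzukiHat φ 0) / suzukiZeroParam (ρ : ℂ)) *
        screwBasis (ρ : ℂ) x := by
  obtain ⟨M, hM0, hM⟩ := exists_norm_hatDiff_le hφ
  -- `‖x − γ̄‖ = ‖x − γ‖` for real `x`
  have hconj : ∀ ρ : ZetaZeros.riemannZetaNontrivialZeros,
      ‖(x : ℂ) - conj (suzukiZeroParam (ρ : ℂ))‖ = ‖(x : ℂ) - suzukiZeroParam (ρ : ℂ)‖ := by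
    intro ρ
    rw [← Complex.norm_conj ((x : ℂ) - suzukiZeroParam (ρ : ℂ)), map_sub, Complex.conj_ofReal]
  have hS : Summable fun ρ : ZetaZeros.riemannZetaNontrivialZeros ↦
      M * ‖1 + lagariasTheta (x : ℂ)‖ / 2 * ((riemannZetaZeroOrder (ρ : ℂ) : ℝ) /
        (‖suzukiZeroParam (ρ : ℂ)‖ * ‖(x : ℂ) - suzukiZeroParam (ρ : ℂ)‖)) :=
    ((summable_zeroOrder_div_norm_mul (x : ℂ)).mul_left (M * ‖1 + lagariasTheta (x : ℂ)‖ / 2)).congr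
      fun ρ ↦ by rw [hconj ρ]
  refine Summable.of_norm_bounded hS fun ρ ↦ ?_
  have hm0 : (0 : ℝ) ≤ riemannZetaZeroOrder (ρ : ℂ) := ZetaZeroSum.zeroOrder_nonneg ρ
  have hsq : Real.sqrt (Real.pi * riemannZetaZeroOrder (ρ : ℂ)) *
      Real.sqrt ((riemannZetaZeroOrder (ρ : ℂ) : ℝ) / Real.pi) = riemannZetaZeroOrder (ρ : ℂ) := by
    rw [← Real.sqrt_mul (by positivity), show Real.pi * (riemannZetaZeroOrder (ρ : ℂ) : ℝ) *
      ((riemannZetaZeroOrder (ρ : ℂ) : ℝ) / Real.pi) = (riemannZetaZeroOrder (ρ : ℂ) : ℝ) *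
      riemannZetaZeroOrder (ρ : ℂ) by field_simp, Real.sqrt_mul_self hm0]
  simp only [norm_mul, norm_div, norm_neg, Complex.norm_real, Real.norm_of_nonneg (Real.sqrt_nonneg _),
    screwBasis, Complex.norm_I, one_mul, Complex.norm_two]
  have hK : 0 ≤ ‖1 + lagariasTheta (x : ℂ)‖ / 2 * ((riemannZetaZeroOrder (ρ : ℂ) : ℝ) /
      (‖suzukiZeroParam (ρ : ℂ)‖ * ‖(x : ℂ) - suzukiZeroParam (ρ : ℂ)‖)) := by positivity
  calc Real.sqrt (Real.pi * riemannZetaZeroOrder (ρ : ℂ)) *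
        ‖suzukiHat φ (suzukiZeroParam (ρ : ℂ)) - suzukiHat φ 0‖ / ‖suzukiZeroParam (ρ : ℂ)‖ *
        (Real.sqrt ((riemannZetaZeroOrder (ρ : ℂ) : ℝ) / Real.pi) * (‖1 + lagariasTheta (x : ℂ)‖ /
          (2 * ‖(x : ℂ) - suzukiZeroParam (ρ : ℂ)‖)))
      = ‖suzukiHat φ (suzukiZeroParam (ρ : ℂ)) - suzukiHat φ 0‖ *
          (‖1 + lagariasTheta (x : ℂ)‖ / 2 * ((Real.sqrt (Real.pi * riemannZetaZeroOrder (ρ : ℂ)) *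
            Real.sqrt ((riemannZetaZeroOrder (ρ : ℂ) : ℝ) / Real.pi)) /
            (‖suzukiZeroParam (ρ : ℂ)‖ * ‖(x : ℂ) - suzukiZeroParam (ρ : ℂ)‖))) := by
        ring
    _ = ‖suzukiHat φ (suzukiZeroParam (ρ : ℂ)) - suzukiHat φ 0‖ *
          (‖1 + lagariasTheta (x : ℂ)‖ / 2 * ((riemannZetaZeroOrder (ρ : ℂ) : ℝ) /
            (‖suzukiZeroParam (ρ : ℂ)‖ * ‖(x : ℂ) - suzukiZeroParam (ρ : ℂ)‖))) := by rw [hsq]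
    _ ≤ M * (‖1 + lagariasTheta (x : ℂ)‖ / 2 * ((riemannZetaZeroOrder (ρ : ℂ) : ℝ) /
            (‖suzukiZeroParam (ρ : ℂ)‖ * ‖(x : ℂ) - suzukiZeroParam (ρ : ℂ)‖))) :=
        mul_le_mul_of_nonneg_right (hM ρ) hK
    _ = M * ‖1 + lagariasTheta (x : ℂ)‖ / 2 * ((riemannZetaZeroOrder (ρ : ℂ) : ℝ) /
            (‖suzukiZeroParam (ρ : ℂ)‖ * ‖(x : ℂ) - suzukiZeroParam (ρ : ℂ)‖)) := by ring

end ScrewLineRepairedEq48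

open ScrewLineRepairedEq48

/-! ## C. (4.8)ᴿ under RH -/

/-- **CJM (4.8) over the repaired screw line: under RH,
`‖P̂ᴿ_φ‖²_{L²(ℝ)} = π Σ_ρ m_ρ |(φ̂(γ_ρ) − φ̂(0))/γ_ρ|²`** for every `φ ∈ C_c^∞(ℝ)`, the series
converging — "by (3.7) and Proposition 4.1": `P̂ᴿ_φ = Σ c_ρ F_ρ` a.e. (`screwPhatR_eq_tsum_screwBasis`),
`{F_ρ}` orthonormal in `L²(ℝ)` under RH (`Suzuki2025_prop41_holds`), `Σ|c_ρ|² < ∞`, Parseval.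
RH-CONSEQUENCE (binder explicit). [cite: Suzuki2025WeilHilbertSpace, (4.8) (TeX l.1288–1296); erratum E21] -/
theorem Suzuki2025_eq48R (hRH : RiemannHypothesis) {φ : ℝ → ℂ} (hφ : IsWeilTest φ) :
    (Summable fun ρ : ZetaZeros.riemannZetaNontrivialZeros ↦ (riemannZetaZeroOrder (ρ : ℂ) : ℝ) *
        ‖suzukiHat φ (suzukiZeroParam (ρ : ℂ)) - suzukiHat φ 0‖ ^ 2 / ‖suzukiZeroParam (ρ : ℂ)‖ ^ 2) ∧
      ∫ x : ℝ, ‖screwPhatR φ x‖ ^ 2 = Real.pi *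
        ∑' ρ : ZetaZeros.riemannZetaNontrivialZeros, (riemannZetaZeroOrder (ρ : ℂ) : ℝ) *
          ‖suzukiHat φ (suzukiZeroParam (ρ : ℂ)) - suzukiHat φ 0‖ ^ 2 / ‖suzukiZeroParam (ρ : ℂ)‖ ^ 2 := by
  classical
  obtain ⟨⟨hF, hON, -⟩, -, -⟩ := Suzuki2025_prop41_holds hRH
  obtain ⟨M, hM0, hM⟩ := exists_norm_hatDiff_le hφ
  -- the real series converges (RH-free)
  have hsumR : Summable fun ρ : ZetaZeros.riemannZetaNontrivialZeros ↦ (riemannZetaZeroOrder (ρ : ℂ) : ℝ) *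
      ‖suzukiHat φ (suzukiZeroParam (ρ : ℂ)) - suzukiHat φ 0‖ ^ 2 / ‖suzukiZeroParam (ρ : ℂ)‖ ^ 2 := by
    refine Summable.of_nonneg_of_le (fun ρ ↦ by
        have := ZetaZeroSum.zeroOrder_nonneg ρ; positivity)
      (fun ρ ↦ ?_) (summable_zeroOrder_div_norm_zeroParam_sq.mul_left (M ^ 2))
    have hm0 : (0 : ℝ) ≤ riemannZetaZeroOrder (ρ : ℂ) := ZetaZeroSum.zeroOrder_nonneg ρ
    rw [show (riemannZetaZeroOrder (ρ : ℂ) : ℝ) *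
        ‖suzukiHat φ (suzukiZeroParam (ρ : ℂ)) - suzukiHat φ 0‖ ^ 2 / ‖suzukiZeroParam (ρ : ℂ)‖ ^ 2 =
        ‖suzukiHat φ (suzukiZeroParam (ρ : ℂ)) - suzukiHat φ 0‖ ^ 2 *
          ((riemannZetaZeroOrder (ρ : ℂ) : ℝ) / ‖suzukiZeroParam (ρ : ℂ)‖ ^ 2) by ring]
    exact mul_le_mul_of_nonneg_right (pow_le_pow_left₀ (norm_nonneg _) (hM ρ) 2) (by positivity)
  refine ⟨hsumR, ?_⟩
  -- coefficients
  set c : ZetaZeros.riemannZetaNontrivialZeros → ℂ := fun ρ ↦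
    -((Real.sqrt (Real.pi * riemannZetaZeroOrder (ρ : ℂ)) : ℝ) : ℂ) *
      (suzukiHat φ (suzukiZeroParam (ρ : ℂ)) - suzukiHat φ 0) / suzukiZeroParam (ρ : ℂ) with hc
  have hc2 : ∀ ρ : ZetaZeros.riemannZetaNontrivialZeros, ‖c ρ‖ ^ 2 =
      Real.pi * ((riemannZetaZeroOrder (ρ : ℂ) : ℝ) *
        ‖suzukiHat φ (suzukiZeroParam (ρ : ℂ)) - suzukiHat φ 0‖ ^ 2 / ‖suzukiZeroParam (ρ : ℂ)‖ ^ 2) := by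
    intro ρ
    have hm0 : (0 : ℝ) ≤ riemannZetaZeroOrder (ρ : ℂ) := ZetaZeroSum.zeroOrder_nonneg ρ
    simp only [hc, norm_mul, norm_div, norm_neg, Complex.norm_real,
      Real.norm_of_nonneg (Real.sqrt_nonneg _)]
    rw [div_pow, mul_pow, Real.sq_sqrt (by positivity)]
    ring
  have hcsum : Summable fun ρ ↦ ‖c ρ‖ ^ 2 := (hsumR.mul_left Real.pi).congr fun ρ ↦ (hc2 ρ).symm
  obtain ⟨hsG, hnormG⟩ := ScrewLineRepairedEq48.summable_and_norm_sq_tsum hON hcsum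
  set G : Lp ℂ 2 (volume : Measure ℝ) :=
    ∑' ρ, c ρ • ((hF ρ).toLp _ : Lp ℂ 2 (volume : Measure ℝ)) with hG
  have hGae : (G : ℝ → ℂ) =ᵐ[volume] fun x ↦ screwPhatR φ x := by
    have h1 := ScrewLineRepairedEq48.coeFn_tsum_ae_eq_tsum hF hsG
      (ae_of_all _ fun x ↦ summable_coeff_mul_screwBasis' hφ x)
    filter_upwards [h1, ae_good_point] with x hx ⟨hx0, hE, hxΓ, hxΓ'⟩
    rw [hx, screwPhatR_eq_tsum_screwBasis hφ hx0 hE hxΓ hxΓ']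
  have hint : ∫ x : ℝ, ‖screwPhatR φ x‖ ^ 2 = ‖G‖ ^ 2 := by
    rw [ScrewLineRepairedEq48.norm_sq_eq_integral_norm_sq]
    refine integral_congr_ae ?_
    filter_upwards [hGae] with x hx
    rw [hx]
  rw [hint, hG, hnormG, ← tsum_mul_left]
  exact tsum_congr hc2

end Literature.NumberTheory.LFunctions
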